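import Literature.NumberTheory.EllipticCurves.LeadingTermPPartProofs
import Literature.NumberTheory.EllipticCurves.AnalyticRankOrderProofs
import HarnessLib

/-!
# Stub `stub_baseVanishing` (line `Sketch` = `kurihara-fourier-support`, crux `PlecticLegs.TwistSupply`)

Base vanishing of the rational plus symbol: if `f ∈ S₂(Γ₀(N))` is the newform of the elliptic
curve `W / ℚ` (`IsNewformOf W f`) and `r_an(W) ≥ 1`, then `[0]⁺_f = L(W,1)/Ω⁺_f = 0`.

Proof: `W.analyticRank ≠ 0`, so by `WeierstrassCurve.analyticRank_eq_zero_iff_holds` (the entire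
continuation being supplied by `IsNewformOf.hasEntireLFunction`) `L(W,1) = W.entireLFunction 1 = 0`;
by `IsNewformOf.entireLFunction_one_eq`, `L(W,1) = [0]⁺_f · Ω⁺_f` in `ℂ` with `Ω⁺_f > 0`
(`IsNewform0.plusPeriod_pos_holds`), whence `([0]⁺_f : ℝ) = 0` and `[0]⁺_f = 0` in `ℚ`.
-/

noncomputable section

set_option linter.dupNamespace false

namespace Summit.BirchSwinnertonDyer.BirchSwinnertonDyer.Theorems

open CongruenceSubgroup WeierstrassCurve Literature.NumberTheory.EllipticCurves
  Literature.NumberTheory.EllipticCurves.ModularForms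

open scoped MatrixGroups ModularForm

/-- `L(W, 1) = 0` when `r_an(W) ≥ 1`, for a Weierstrass curve `W / ℚ` with a newform `f`
(so that `L(W, s)` has an entire continuation, `IsNewformOf.hasEntireLFunction`): the contrapositive
of `WeierstrassCurve.analyticRank_eq_zero_iff_holds` (`r_an = 0 ↔ L(W,1) ≠ 0`). -/
theorem baseVanishing_entireLFunction_one_eq_zero {W : WeierstrassCurve ℚ} [W.IsElliptic]
    {N : ℕ} [NeZero N] {f : CuspForm (Gamma0 N) 2} (hf : IsNewformOf W f)
    (hr : 1 ≤ W.analyticRank) : W.entireLFunction 1 = 0 := by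
  by_contra hne
  have h0 : W.analyticRank = 0 :=
    (analyticRank_eq_zero_iff_holds (W := W) hf.hasEntireLFunction).mpr hne
  omega

/-- **Base vanishing** (registered stub `stub_baseVanishing` of line `Sketch`): if `r_an(W) ≥ 1`
then `[0]⁺_f = L(W,1)/Ω⁺_f = 0` for the newform `f` of `W`: `L(W,1) = 0`
(`baseVanishing_entireLFunction_one_eq_zero`), `L(W,1) = [0]⁺_f · Ω⁺_f`
(`IsNewformOf.entireLFunction_one_eq`) and `Ω⁺_f > 0` (`IsNewform0.plusPeriod_pos_holds`). -/
theorem stub_baseVanishing :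
    ∀ (W : WeierstrassCurve ℚ) [W.IsElliptic] (N : ℕ) [NeZero N] (f : CuspForm (Gamma0 N) 2),
      IsNewformOf W f → 1 ≤ W.analyticRank → ratPlusSymbol f 0 = 0 := by
  intro W _ N _ f hf hr
  have hL : W.entireLFunction 1 = 0 := baseVanishing_entireLFunction_one_eq_zero hf hr
  have hpos : 0 < plusPeriod f := IsNewform0.plusPeriod_pos_holds hf.1 hf.coeffField_eq_bot
  have hreal : ((ratPlusSymbol f 0 : ℚ) : ℝ) * plusPeriod f = 0 := by
    have h : W.entireLFunction 1 = ((((ratPlusSymbol f 0 : ℚ) : ℝ) * plusPeriod f : ℝ) : ℂ) :=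
      hf.entireLFunction_one_eq
    rw [hL] at h
    exact_mod_cast h.symm
  have hq : ((ratPlusSymbol f 0 : ℚ) : ℝ) = 0 := (mul_eq_zero.mp hreal).resolve_right hpos.ne'
  exact_mod_cast hq

end Summit.BirchSwinnertonDyer.BirchSwinnertonDyer.Theorems

end
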